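import Mathlib
import HarnessLib
import Summits.QuantumAdvantage.QuantumAdvantage.Theses.RegulatorThird
import Literature.Computability.Complexity.ReductionsProofs

/-!
# Birth skeleton — piece `CanonicalRepGivenDenominatorFP` of the `OneThirdFP` split (stmt-QuantumAdvantage-15982)

Line: LIST then SELECT.  `stub_candidateListFP` (the infrastructure content, XL): from `⟨⟨bin s, bin r⟩, bin n*⟩`
an `FP` machine outputs a list of class members (triples, each a genuine representative) that CONTAINS the least
triple — the ideal `𝔟` is explicit from `n*` (`(b, √s)` up to the 2-adjustment, `b² ∣ n*`), walk the cycle of `[𝔟]`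
by giant steps to the two 3-division targets (`r`), recover each candidate `n* η^{±1} w³` exactly from residues
(Jacobson–Williams 2008 Ch. 12; tree `JacobsonWilliams2008_unitResidue_mem_FP_holds`), list the small combinations of
the `O(log s)` adjacent lattice minima in the admissible scale window.  `stub_selectLeastFP` (pure `FP` programming, L):
from the coded list, output the key-then-lexicographic least element (integer comparisons, one pass; bricks of
`Literature/Computability/Complexity/BrickAlgebra.lean`).  Composition `canonicalRepGivenDenominatorFP_of`: `S ∘ L`;
the least triple is in the list and beats every listed member (all members are representatives), so `S` returns it.
-/

set_option linter.dupNamespace false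

namespace Summit.QuantumAdvantage.QuantumAdvantage.Cruxes.OneThirdFP.BirthCanonicalRepGivenDenominatorFP

open Literature.Computability.Complexity

/-- Membership of `(A + B√s)/n` in `η K^{×3} ∪ η⁻¹ K^{×3}` — verbatim the route's inlined clause. -/
def IsRep (s : ℕ) (A B : ℤ) (n : ℕ) : Prop :=
  (0 < n ∧ ∀ (K : Type) [Field K] [NumberField K], Module.finrank ℚ K = 2 → ∀ α : K, α ^ 2 = (s : K) → ∀ u : (NumberField.RingOfIntegers K)ˣ, (∀ v : (NumberField.RingOfIntegers K)ˣ, ∃ m : ℤ, v = u ^ m ∨ v = -(u ^ m)) → ∃ z : K, z ≠ 0 ∧ (((A : K) + (B : K) * α) / (n : K) = ((u : NumberField.RingOfIntegers K) : K) * z ^ 3 ∨ ((A : K) + (B : K) * α) / (n : K) = ((u⁻¹ : (NumberField.RingOfIntegers K)ˣ) : NumberField.RingOfIntegers K) * z ^ 3))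

/-- The key-then-lexicographic order clause of the route, verbatim. -/
def KeyLE (A B : ℤ) (n : ℕ) (A' B' : ℤ) (n' : ℕ) : Prop :=
  (|A| + |B| + n < |A'| + |B'| + n' ∨ (|A| + |B| + n = |A'| + |B'| + n' ∧ (A < A' ∨ (A = A' ∧ (B < B' ∨ (B = B' ∧ n ≤ n'))))))

/-- `(A, B, n)` is the LEAST representative — verbatim the route's inlined conjunction. -/
def IsLeast (s : ℕ) (A B : ℤ) (n : ℕ) : Prop :=
  IsRep s A B n ∧ ∀ (A' B' : ℤ) (n' : ℕ), IsRep s A' B' n' → KeyLE A B n A' B' n'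

/-- The route's code of a triple. -/
def code (A B : ℤ) (n : ℕ) : List Bool :=
  Literature.Computability.Complexity.boolPair (Literature.Computability.Complexity.boolPair (Computability.encodeNat A.natAbs) (Computability.encodeNat B.natAbs)) (Literature.Computability.Complexity.boolPair (Computability.encodeNat n) [decide (A < 0), decide (B < 0)])

/-- Code of a list of triples: right-nested `boolPair`s of the triple codes, terminated by `[]`. -/
def codeList : List (ℤ × ℤ × ℕ) → List Bool
  | [] => []
  | t :: l => boolPair (code t.1 t.2.1 t.2.2) (codeList l)

/-- STUB (infrastructure, XL): an `FP` lister of genuine class members containing the least triple, given the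
denominator as advice. -/
theorem stub_candidateListFP :
    ∃ L ∈ Literature.Computability.Complexity.FP, ∀ (s r : ℕ), Squarefree s → 1 < s → (∀ (K : Type) [Field K] [NumberField K], Module.finrank ℚ K = 2 → (∃ α : K, α ^ 2 = (s : K)) → |NumberField.Units.regulator K - (r : ℝ)| ≤ 1) → ∀ (A B : ℤ) (n : ℕ), IsLeast s A B n → (∃ b : ℕ, Squarefree b ∧ b ∣ 2 * s ∧ (n = b ^ 2 ∨ n = 2 * b ^ 2)) → ∃ l : List (ℤ × ℤ × ℕ), L (Literature.Computability.Complexity.boolPair (Literature.Computability.Complexity.boolPair (Computability.encodeNat s) (Computability.encodeNat r)) (Computability.encodeNat n)) = codeList l ∧ (A, B, n) ∈ l ∧ ∀ t ∈ l, IsRep s t.1 t.2.1 t.2.2 := by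
  sorry

/-- STUB (FP programming, L): select the key-then-lexicographic least element of a coded list of triples. -/
theorem stub_selectLeastFP :
    ∃ S ∈ Literature.Computability.Complexity.FP, ∀ l : List (ℤ × ℤ × ℕ), ∀ (A B : ℤ) (n : ℕ), (A, B, n) ∈ l → (∀ t ∈ l, KeyLE A B n t.1 t.2.1 t.2.2) → S (codeList l) = code A B n := by
  sorry

/-- Composition: LIST then SELECT gives the piece `CanonicalRepGivenDenominatorFP` (statement verbatim as filed). -/
theorem canonicalRepGivenDenominatorFP_of
    (hL : ∃ L ∈ Literature.Computability.Complexity.FP, ∀ (s r : ℕ), Squarefree s → 1 < s → (∀ (K : Type) [Field K] [NumberField K], Module.finrank ℚ K = 2 → (∃ α : K, α ^ 2 = (s : K)) → |NumberField.Units.regulator K - (r : ℝ)| ≤ 1) → ∀ (A B : ℤ) (n : ℕ), IsLeast s A B n → (∃ b : ℕ, Squarefree b ∧ b ∣ 2 * s ∧ (n = b ^ 2 ∨ n = 2 * b ^ 2)) → ∃ l : List (ℤ × ℤ × ℕ), L (Literature.Computability.Complexity.boolPair (Literature.Computability.Complexity.boolPair (Computability.encodeNat s) (Computability.encodeNat r))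 (Computability.encodeNat n)) = codeList l ∧ (A, B, n) ∈ l ∧ ∀ t ∈ l, IsRep s t.1 t.2.1 t.2.2)
    (hS : ∃ S ∈ Literature.Computability.Complexity.FP, ∀ l : List (ℤ × ℤ × ℕ), ∀ (A B : ℤ) (n : ℕ), (A, B, n) ∈ l → (∀ t ∈ l, KeyLE A B n t.1 t.2.1 t.2.2) → S (codeList l) = code A B n) :
    ∃ g ∈ Literature.Computability.Complexity.FP, ∀ (s r : ℕ), Squarefree s → 1 < s → (∀ (K : Type) [Field K] [NumberField K], Module.finrank ℚ K = 2 → (∃ α : K, α ^ 2 = (s : K)) → |NumberField.Units.regulator K - (r : ℝ)| ≤ 1) → ∀ (A B : ℤ) (n : ℕ), ((0 < n ∧ ∀ (K : Type) [Field K] [NumberField K], Module.finrank ℚ K = 2 → ∀ α : K, α ^ 2 = (s : K) → ∀ u : (NumberField.RingOfIntegers K)ˣ, (∀ v : (NumberField.RingOfIntegers K)ˣ, ∃ m : ℤ, v = u ^ m ∨ v = -(u ^ m)) → ∃ z : K, z ≠ 0 ∧ (((A : K) + (B : K) * α) / (n : K) = ((u : NumberField.RingOfIntegers K) : K) * z ^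 3 ∨ ((A : K) + (B : K) * α) / (n : K) = ((u⁻¹ : (NumberField.RingOfIntegers K)ˣ) : NumberField.RingOfIntegers K) * z ^ 3)) ∧ ∀ (A' B' : ℤ) (n' : ℕ), (0 < n' ∧ ∀ (K : Type) [Field K] [NumberField K], Module.finrank ℚ K = 2 → ∀ α : K, α ^ 2 = (s : K) → ∀ u : (NumberField.RingOfIntegers K)ˣ, (∀ v : (NumberField.RingOfIntegers K)ˣ, ∃ m : ℤ, v = u ^ m ∨ v = -(u ^ m)) → ∃ z : K, z ≠ 0 ∧ (((A' : K) + (B' : K) * α) / (n' : K) = ((u : NumberField.RingOfIntegers K) : K) * z ^ 3 ∨ ((A' : K) + (B' : K) * α) / (n' : K) = ((u⁻¹ : (NumberField.RingOfIntegers K)ˣ) : NumberField.RingOfIntegers K) * z ^ 3)) → (|A| + |B| + n < |A'| + |B'| + n' ∨ (|A| + |B| + n = |A'| + |B'| + n' ∧ (A < A' ∨ (A = A' ∧ (B < B' ∨ (B = B' ∧ n ≤ n'))))))) → (∃ b : ℕ, Squarefree b ∧ b ∣ 2 * s ∧ (n = b ^ 2 ∨ n = 2 * b ^ 2)) → g (Literature.Computability.Complexity.boolPair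 (Literature.Computability.Complexity.boolPair (Computability.encodeNat s) (Computability.encodeNat r)) (Computability.encodeNat n)) = Literature.Computability.Complexity.boolPair (Literature.Computability.Complexity.boolPair (Computability.encodeNat A.natAbs) (Computability.encodeNat B.natAbs)) (Literature.Computability.Complexity.boolPair (Computability.encodeNat n) [decide (A < 0), decide (B < 0)]) := by
  obtain ⟨L, hLfp, hLspec⟩ := hL
  obtain ⟨S, hSfp, hSspec⟩ := hS
  refine ⟨S ∘ L, comp_mem_FP hSfp hLfp, ?_⟩
  intro s r hs h1s hreg A B n hleast hshape
  obtain ⟨l, hl, hmem, hreps⟩ := hLspec s r hs h1s hreg A B n hleast hshape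
  have hmin : ∀ t ∈ l, KeyLE A B n t.1 t.2.1 t.2.2 := fun t ht => hleast.2 t.1 t.2.1 t.2.2 (hreps t ht)
  show S (L _) = _
  rw [hl]
  exact hSspec l A B n hmem hmin

/-- Sanity: `IsLeast` is by definition the route's inlined least-representative clause. -/
example (s : ℕ) (A B : ℤ) (n : ℕ) : IsLeast s A B n ↔ ((0 < n ∧ ∀ (K : Type) [Field K] [NumberField K], Module.finrank ℚ K = 2 → ∀ α : K, α ^ 2 = (s : K) → ∀ u : (NumberField.RingOfIntegers K)ˣ, (∀ v : (NumberField.RingOfIntegers K)ˣ, ∃ m : ℤ, v = u ^ m ∨ v = -(u ^ m)) → ∃ z : K, z ≠ 0 ∧ (((A : K) + (B : K) * α) / (n : K) = ((u : NumberField.RingOfIntegers K) : K) * z ^ 3 ∨ ((A : K) + (B : K) * α) / (n : K) = ((u⁻¹ : (NumberField.RingOfIntegers K)ˣ) : NumberField.RingOfIntegers K) * z ^ 3)) ∧ ∀ (A' B' : ℤ) (n' : ℕ), (0 < n' ∧ ∀ (K : Type) [Field K] [NumberField K], Module.finrank ℚ K = 2 → ∀ α : K, α ^ 2 = (s : K)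 → ∀ u : (NumberField.RingOfIntegers K)ˣ, (∀ v : (NumberField.RingOfIntegers K)ˣ, ∃ m : ℤ, v = u ^ m ∨ v = -(u ^ m)) → ∃ z : K, z ≠ 0 ∧ (((A' : K) + (B' : K) * α) / (n' : K) = ((u : NumberField.RingOfIntegers K) : K) * z ^ 3 ∨ ((A' : K) + (B' : K) * α) / (n' : K) = ((u⁻¹ : (NumberField.RingOfIntegers K)ˣ) : NumberField.RingOfIntegers K) * z ^ 3)) → (|A| + |B| + n < |A'| + |B'| + n' ∨ (|A| + |B| + n = |A'| + |B'| + n' ∧ (A < A' ∨ (A = A' ∧ (B < B' ∨ (B = B' ∧ n ≤ n'))))))) := Iff.rfl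

end Summit.QuantumAdvantage.QuantumAdvantage.Cruxes.OneThirdFP.BirthCanonicalRepGivenDenominatorFP
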